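import Mathlib
import Literature.NumberTheory.Automorphic.ResGLnHermitianCone
import Literature.NumberTheory.Automorphic.ResGLnHermitianConeOpen
import HarnessLib

/-!
# The radial projection of the positive cone of `Res_{K/ℚ} GL_n` — crux HeckeEigenvalueField
(stmt-Langlands-13632), line Sketch, stub RADIAL

On the open cone `posCone n K ⊆ hermSpace n K`, with `N(H) = N_{K_∞/ℝ}(det H)`, `e = 1/(n[K:ℚ])`,
`p(H) = N(H)^{-e} H`, we prove `stub_radialProjection`: positivity and homogeneity of `N`, `p` is a
scale-invariant equivariant retraction onto `{N = 1}`, smooth (`p = (N²)^{-e/2} · id`, `N²` a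
polynomial) with first two derivatives `≤ C (1 + ‖H‖ + N(H)⁻¹)ᵏ` (homogeneity of `N²`, compact unit
sphere, Faà di Bruno and Leibniz bounds), and `(p^*ω)_H = ω_H` for basic forms `ω`. Folklore.
-/

set_option linter.dupNamespace false -- project-wide: `Summit.Langlands.Langlands` is the namespace

noncomputable section

open scoped ComplexOrder Matrix Matrix.Norms.Elementwise Classical
open NumberField NumberField.mixedEmbedding Literature.NumberTheory.Automorphic Set

namespace Summit.Langlands.Langlands.Theorems.HeckeEigenvalueField.Res

namespace Radial

open scoped ContDiff

/-- **Homogeneous smooth functions have polynomially bounded derivatives**: `F(rx) = rᵏ F(x)`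
gives `Dⁱ F(x) = ‖x‖^{k-i} Dⁱ F(x/‖x‖)`, and `Dⁱ F` is bounded on the compact sphere. [folklore] -/
theorem norm_iteratedFDeriv_le_of_homogeneous {E : Type*} [NormedAddCommGroup E]
    [NormedSpace ℝ E] [FiniteDimensional ℝ E] {F : E → ℝ} (hF : ContDiff ℝ ∞ F) {k i : ℕ}
    (hik : i ≤ k) (hhom : ∀ r : ℝ, 0 < r → ∀ x, F (r • x) = r ^ k * F x) :
    ∃ S : ℝ, ∀ x, ‖iteratedFDeriv ℝ i F x‖ ≤ S * (1 + ‖x‖) ^ k := by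
  have hFi : ContDiff ℝ i F := hF.of_le (by exact_mod_cast le_top)
  obtain ⟨S₀, hS₀⟩ := (isCompact_sphere (0 : E) 1).exists_bound_of_continuousOn
    ((hF.continuous_iteratedFDeriv (m := i) (by exact_mod_cast le_top)).continuousOn)
  set S : ℝ := max (max S₀ 0) ‖iteratedFDeriv ℝ i F 0‖ with hS_def
  have hS0 : 0 ≤ S := le_trans (le_max_right _ _) (le_max_left _ _)
  refine ⟨S, fun x => ?_⟩
  have h1 : (1 : ℝ) ≤ (1 + ‖x‖) ^ k := one_le_pow₀ (by simp)
  by_cases hx : x = 0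
  · subst hx
    exact (le_max_right _ _).trans (le_mul_of_one_le_right hS0 h1)
  set r : ℝ := ‖x‖ with hr_def
  have hr : 0 < r := norm_pos_iff.mpr hx
  have hu : r⁻¹ • x ∈ Metric.sphere (0 : E) 1 := by
    rw [mem_sphere_zero_iff_norm, _root_.norm_smul, norm_inv, Real.norm_of_nonneg hr.le,
      inv_mul_cancel₀ hr.ne']
  have key : r ^ i • iteratedFDeriv ℝ i F x = r ^ k • iteratedFDeriv ℝ i F (r⁻¹ • x) := by
    have h2 : (fun z => F (r • z)) = r ^ k • F :=
      funext fun z => by rw [hhom r hr z, Pi.smul_apply, smul_eq_mul]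
    have h3 := congrFun (iteratedFDeriv_comp_const_smul (f := F) r hFi) (r⁻¹ • x)
    rw [h2, iteratedFDeriv_const_smul_apply hFi.contDiffAt, smul_inv_smul₀ hr.ne'] at h3
    exact h3.symm
  have hnorm := congrArg (fun v => ‖v‖) key
  simp only [_root_.norm_smul, norm_pow, Real.norm_of_nonneg hr.le] at hnorm
  rw [show r ^ k = r ^ i * r ^ (k - i) by rw [← pow_add, Nat.add_sub_cancel' hik],
    mul_assoc] at hnorm
  rw [mul_left_cancel₀ (pow_pos hr i).ne' hnorm]
  calc r ^ (k - i) * ‖iteratedFDeriv ℝ i F (r⁻¹ • x)‖ ≤ (1 + r) ^ k * S := by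
        refine mul_le_mul ((pow_le_pow_left₀ hr.le (by linarith) _).trans
          (pow_le_pow_right₀ (by linarith) (Nat.sub_le k i))) ?_ (norm_nonneg _) (by positivity)
        exact (hS₀ _ hu).trans (le_trans (le_max_left _ _) (le_max_left _ _))
    _ = S * (1 + ‖x‖) ^ k := by rw [hr_def, mul_comm]

/-- The derivatives of `t ↦ tᵃ` (`-1 ≤ a ≤ 0`) on `(0, ∞)` up to order two are `≤ 2 (1 + t⁻¹)³`
(`Real.iter_deriv_rpow_const`). [folklore] -/
theorem norm_iteratedFDerivWithin_rpow_le {a : ℝ} (ha₀ : a ≤ 0) (ha₁ : -1 ≤ a) {t : ℝ}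
    (ht : 0 < t) {i : ℕ} (hi : i ≤ 2) :
    ‖iteratedFDerivWithin ℝ i (fun s : ℝ => s ^ a) (Ioi 0) t‖ ≤ 2 * (1 + t⁻¹) ^ 3 := by
  rw [iteratedFDerivWithin_of_isOpen i isOpen_Ioi ht, norm_iteratedFDeriv_eq_norm_iteratedDeriv,
    iteratedDeriv_eq_iterate, Real.iter_deriv_rpow_const, norm_mul,
    Real.norm_of_nonneg (Real.rpow_nonneg ht.le _)]
  have hcoef : ‖(descPochhammer ℝ i).eval a‖ ≤ 2 := by
    interval_cases i
    · simp
    · rw [descPochhammer_succ_eval, descPochhammer_zero, Polynomial.eval_one, one_mul,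
        Nat.cast_zero, sub_zero, Real.norm_eq_abs, abs_of_nonpos ha₀]
      linarith
    · rw [descPochhammer_succ_eval, descPochhammer_succ_eval, descPochhammer_zero,
        Polynomial.eval_one, one_mul, Nat.cast_zero, sub_zero, Nat.cast_one, norm_mul,
        Real.norm_eq_abs, Real.norm_eq_abs, abs_of_nonpos ha₀, abs_of_nonpos (by linarith)]
      nlinarith
  have hpow : t ^ (a - (i : ℕ)) ≤ (1 + t⁻¹) ^ 3 := by
    have hi' : (i : ℝ) ≤ 2 := by exact_mod_cast hi
    have h1 : (1 : ℝ) ≤ 1 + t⁻¹ := le_add_of_nonneg_right (inv_nonneg.mpr ht.le)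
    rw [show a - (i : ℕ) = -((i : ℝ) - a) by ring, Real.rpow_neg ht.le, ← Real.inv_rpow ht.le]
    calc t⁻¹ ^ ((i : ℝ) - a) ≤ (1 + t⁻¹) ^ ((i : ℝ) - a) :=
          Real.rpow_le_rpow (inv_nonneg.mpr ht.le) (by linarith) (by linarith)
      _ ≤ (1 + t⁻¹) ^ ((3 : ℕ) : ℝ) := Real.rpow_le_rpow_of_exponent_le h1 (by norm_num; linarith)
      _ = (1 + t⁻¹) ^ 3 := Real.rpow_natCast _ _
  exact mul_le_mul hcoef hpow (Real.rpow_nonneg ht.le _) (by norm_num)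

/-- The iterated derivatives `x, id, 0, …` of the identity have norm `≤ 1 + ‖x‖`. [folklore] -/
theorem norm_iteratedFDeriv_id_le {E : Type*} [NormedAddCommGroup E] [NormedSpace ℝ E] (x : E)
    (j : ℕ) : ‖iteratedFDeriv ℝ j (fun y : E => y) x‖ ≤ 1 + ‖x‖ := by
  rcases j with _ | _ | j
  · rw [norm_iteratedFDeriv_zero]
    linarith [norm_nonneg x]
  · rw [norm_iteratedFDeriv_one, fderiv_fun_id]
    exact ContinuousLinearMap.norm_id_le.trans (le_add_of_nonneg_right (norm_nonneg _))
  · have h1 : fderiv ℝ (fun y : E => y) = fun _ => ContinuousLinearMap.id ℝ E :=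
      funext fun _ => fderiv_fun_id
    have h : iteratedFDeriv ℝ (j + 2) (fun y : E => y) x = 0 := by
      simp only [iteratedFDeriv_succ_eq_comp_right, Function.comp_apply, h1,
        iteratedFDeriv_succ_const, Pi.zero_apply, map_zero]
    rw [h, norm_zero]
    linarith [norm_nonneg x]

/-- **Calculus of `y ↦ N(y)^{-e} y`** (`N ≥ 0` homogeneous of degree `m ≥ 1`, `N²` smooth,
`0 < e ≤ 1`) on an open set where `N > 0`: smooth, derivative `N(x)^{-e} id + ℓ ⊗ x`, and first two
derivatives `≤ C Xᵏ`, `X = 1 + ‖x‖ + N(x)⁻¹` (`N^{-e} = (N²)^{-e/2}`; homogeneity bounds `Dⁱ(N²)` by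
`S X^{2m}`, `|Dⁱ t^{-e/2}| ≤ 2 X⁶` at `t = N(x)²`, then Faà di Bruno and Leibniz). [folklore] -/
theorem rpow_smul_calculus {E : Type*} [NormedAddCommGroup E] [NormedSpace ℝ E]
    [FiniteDimensional ℝ E] {N : E → ℝ} (hN2 : ContDiff ℝ ∞ fun y => N y ^ 2)
    (hN0 : ∀ y, 0 ≤ N y) {m : ℕ} (hm : 1 ≤ m)
    (hhom : ∀ r : ℝ, 0 < r → ∀ y, N (r • y) = r ^ m * N y) {e : ℝ} (he₀ : 0 < e) (he₁ : e ≤ 1)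
    {s : Set E} (hs : IsOpen s) (hNs : ∀ y ∈ s, 0 < N y) :
    (∀ x ∈ s, ContDiffAt ℝ ∞ (fun y => N y ^ (-e) • y) x ∧
      ∃ ℓ : E →L[ℝ] ℝ, fderiv ℝ (fun y => N y ^ (-e) • y) x =
        N x ^ (-e) • ContinuousLinearMap.id ℝ E + ℓ.smulRight x) ∧
    ∃ C : ℝ, ∃ k : ℕ, ∀ x ∈ s, ∀ v w : E,
      ‖fderiv ℝ (fun y => N y ^ (-e) • y) x v‖ ≤ C * (1 + ‖x‖ + (N x)⁻¹) ^ k * ‖v‖ ∧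
      ‖iteratedFDeriv ℝ 2 (fun y => N y ^ (-e) • y) x ![v, w]‖ ≤
        C * (1 + ‖x‖ + (N x)⁻¹) ^ k * ‖v‖ * ‖w‖ := by
  set a : ℝ := -(e / 2) with ha_def
  have ha₀ : a ≤ 0 := by rw [ha_def]; linarith
  have ha₁ : -1 ≤ a := by rw [ha_def]; linarith
  have hfun : (fun y => N y ^ (-e)) = fun y => (N y ^ 2) ^ a := funext fun y => by
    rw [ha_def, ← Real.rpow_natCast_mul (hN0 y)]
    exact congrArg _ (by push_cast; ring)
  refine ⟨fun x hx => ?_, ?_⟩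
  · have hf : ContDiffAt ℝ ∞ (fun y => N y ^ (-e)) x :=
      hfun ▸ hN2.contDiffAt.rpow_const_of_ne (pow_pos (hNs x hx) 2).ne'
    exact ⟨hf.smul contDiffAt_id, fderiv ℝ (fun y => N y ^ (-e)) x,
      ((hf.differentiableAt (by simp)).hasFDerivAt.smul (hasFDerivAt_id x)).fderiv⟩
  have hMhom : ∀ r : ℝ, 0 < r → ∀ y, N (r • y) ^ 2 = r ^ (2 * m) * N y ^ 2 := fun r hr y => by
    rw [hhom r hr y, mul_pow, ← pow_mul, mul_comm m 2]
  obtain ⟨S₁, hS₁⟩ := norm_iteratedFDeriv_le_of_homogeneous hN2 (i := 1) (by omega) hMhom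
  obtain ⟨S₂, hS₂⟩ := norm_iteratedFDeriv_le_of_homogeneous hN2 (i := 2) (by omega) hMhom
  set S : ℝ := max (max S₁ S₂) 1 with hS_def
  have hS1 : 1 ≤ S := le_max_right _ _
  suffices hmain : ∀ x ∈ s, ∀ i, 1 ≤ i → i ≤ 2 → ‖iteratedFDeriv ℝ i (fun y => N y ^ (-e) • y) x‖ ≤
      16 * S ^ 2 * (1 + ‖x‖ + (N x)⁻¹) ^ (4 * m + 7) by
    refine ⟨16 * S ^ 2, 4 * m + 7, fun x hx v w => ⟨?_, ?_⟩⟩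
    · have hb := hmain x hx 1 le_rfl one_le_two
      rw [norm_iteratedFDeriv_one] at hb
      exact (ContinuousLinearMap.le_opNorm _ v).trans
        (mul_le_mul_of_nonneg_right hb (norm_nonneg v))
    · refine (ContinuousMultilinearMap.le_opNorm _ _).trans ?_
      rw [Fin.prod_univ_two, Matrix.cons_val_zero, Matrix.cons_val_one, Matrix.cons_val_zero,
        ← mul_assoc]
      exact mul_le_mul_of_nonneg_right (mul_le_mul_of_nonneg_right (hmain x hx 2 one_le_two le_rfl)
        (norm_nonneg v)) (norm_nonneg w)
  intro x hx i hi1 hi2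
  rw [show (fun y => N y ^ (-e) • y) = fun y => (N y ^ 2) ^ a • y from
    funext fun y => congrArg (· • y) (congrFun hfun y)]
  have hφ : ContDiffOn ℝ ∞ (fun t : ℝ => t ^ a) (Ioi 0) := fun t ht =>
    (Real.contDiffAt_rpow_const_of_ne (p := a) (ne_of_gt ht)).contDiffWithinAt
  have hmaps : MapsTo (fun y => N y ^ 2) s (Ioi 0) := fun y hy => pow_pos (hNs y hy) 2
  have hNx : 0 < N x := hNs x hx
  -- `X = 1 + ‖x‖ + N⁻¹ ≥ 1`, `(1 + N⁻²)³ ≤ X⁶`, `Sᵢ (1 + ‖x‖)^{2m} ≤ D := S X^{2m}`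
  set X : ℝ := 1 + ‖x‖ + (N x)⁻¹ with hX_def
  have hXn : 1 + ‖x‖ ≤ X := le_add_of_nonneg_right (inv_nonneg.mpr hNx.le)
  have hX1 : 1 ≤ X := le_trans (le_add_of_nonneg_right (norm_nonneg x)) hXn
  have hXi : (1 + (N x ^ 2)⁻¹) ^ 3 ≤ X ^ 6 := by
    have h1 : 1 + (N x)⁻¹ ≤ X := by rw [hX_def]; linarith [norm_nonneg x]
    have h2 : 0 ≤ (N x)⁻¹ := inv_nonneg.mpr hNx.le
    have h3 : 1 + (N x ^ 2)⁻¹ ≤ X ^ 2 :=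
      calc 1 + (N x ^ 2)⁻¹ ≤ (1 + (N x)⁻¹) ^ 2 := by rw [← inv_pow]; nlinarith
        _ ≤ X ^ 2 := pow_le_pow_left₀ (by linarith) h1 2
    simpa only [← pow_mul] using pow_le_pow_left₀ (by positivity) h3 3
  set D : ℝ := S * X ^ (2 * m) with hD_def
  have hD1 : 1 ≤ D := one_le_mul_of_one_le_of_one_le hS1 (one_le_pow₀ hX1)
  have hSD : ∀ S' ≤ S, S' * (1 + ‖x‖) ^ (2 * m) ≤ D := fun S' hS' =>
    (mul_le_mul_of_nonneg_right hS' (by positivity)).trans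
      (mul_le_mul_of_nonneg_left (pow_le_pow_left₀ (by positivity) hXn _) (by linarith))
  -- Faà di Bruno: `‖Dʲ (φ ∘ N²)‖ ≤ j! (2 X⁶) Dʲ ≤ 2 (2 X⁶) D²` for `j ≤ 2`
  have hfj : ∀ j ≤ 2, ‖iteratedFDerivWithin ℝ j (fun y => (N y ^ 2) ^ a) s x‖ ≤
      2 * (2 * X ^ 6) * D ^ 2 := by
    intro j hj
    have h := norm_iteratedFDerivWithin_comp_le (g := fun t : ℝ => t ^ a) (f := fun y => N y ^ 2)
      (n := j) hφ hN2.contDiffOn (by exact_mod_cast le_top) (uniqueDiffOn_Ioi 0) hs.uniqueDiffOn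
      hmaps hx (C := 2 * X ^ 6) (D := D) (fun i hi => (norm_iteratedFDerivWithin_rpow_le ha₀ ha₁
        (pow_pos hNx 2) (hi.trans hj)).trans (by linarith))
      (fun i hi1 hi => by
        rw [iteratedFDerivWithin_of_isOpen i hs hx]
        have hi2 : i ≤ 2 := hi.trans hj
        refine le_trans ?_ (le_self_pow₀ hD1 (by omega))
        interval_cases i
        · exact (hS₁ x).trans (hSD S₁ ((le_max_left _ _).trans (le_max_left _ _)))
        · exact (hS₂ x).trans (hSD S₂ ((le_max_right _ _).trans (le_max_left _ _))))
    have hjf : ((j.factorial : ℕ) : ℝ) ≤ 2 := by interval_cases j <;> simp [Nat.factorial]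
    exact h.trans (mul_le_mul (mul_le_mul_of_nonneg_right hjf (by positivity))
      (pow_le_pow_right₀ hD1 hj) (by positivity) (by positivity))
  rw [← iteratedFDerivWithin_of_isOpen i hs hx]
  refine (norm_iteratedFDerivWithin_smul_le (f := fun y => (N y ^ 2) ^ a) (g := fun y : E => y)
    (hφ.comp hN2.contDiffOn hmaps) contDiffOn_id hs.uniqueDiffOn hx (n := i)
    (by exact_mod_cast le_top)).trans ?_
  have h2i : (∑ j ∈ Finset.range (i + 1), (i.choose j : ℝ)) = 2 ^ i := by
    rw [← Nat.cast_sum, Nat.sum_range_choose]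
    exact Nat.cast_pow 2 i
  have h2i4 : (2 : ℝ) ^ i ≤ 4 := by interval_cases i <;> norm_num
  calc ∑ j ∈ Finset.range (i + 1), (i.choose j : ℝ) *
        ‖iteratedFDerivWithin ℝ j (fun y => (N y ^ 2) ^ a) s x‖ *
          ‖iteratedFDerivWithin ℝ (i - j) (fun y : E => y) s x‖
      ≤ ∑ j ∈ Finset.range (i + 1), (i.choose j : ℝ) * (2 * (2 * X ^ 6) * D ^ 2) * X := by
        refine Finset.sum_le_sum fun j hj => ?_
        have hj2 : j ≤ 2 := by have := Finset.mem_range.mp hj; omega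
        refine mul_le_mul (mul_le_mul_of_nonneg_left (hfj j hj2) (Nat.cast_nonneg _)) ?_
          (norm_nonneg _) (by positivity)
        rw [iteratedFDerivWithin_of_isOpen (i - j) hs hx]
        exact (norm_iteratedFDeriv_id_le x (i - j)).trans hXn
    _ = 2 ^ i * (2 * (2 * X ^ 6) * D ^ 2) * X := by rw [← Finset.sum_mul, ← Finset.sum_mul, h2i]
    _ ≤ 4 * (2 * (2 * X ^ 6) * D ^ 2) * X :=
        mul_le_mul_of_nonneg_right (mul_le_mul_of_nonneg_right h2i4 (by positivity)) (by positivity)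
    _ = 16 * S ^ 2 * X ^ (4 * m + 7) := by rw [hD_def]; ring

/-- **An alternating form killed by `H` ignores rank-one perturbations along `H`**:
`α ∘ ∧(A + ℓ ⊗ H) = α ∘ ∧A` (expand by multilinearity and use antisymmetry). [folklore] -/
theorem compContinuousLinearMap_add_smulRight {E V : Type*} [NormedAddCommGroup E]
    [NormedSpace ℝ E] [NormedAddCommGroup V] [NormedSpace ℝ V] {q : ℕ}
    (α : E [⋀^Fin (q + 1)]→L[ℝ] V) {H : E} (hα : α.curryLeft H = 0) (A : E →L[ℝ] E)
    (ℓ : E →L[ℝ] ℝ) :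
    α.compContinuousLinearMap (A + ℓ.smulRight H) = α.compContinuousLinearMap A := by
  have h0 : ∀ v : Fin (q + 1) → E, v 0 = H → α v = 0 := fun v hv => by
    have h := congrArg (fun β : E [⋀^Fin q]→L[ℝ] V => β (Fin.tail v)) hα
    simp only [ContinuousAlternatingMap.curryLeft_apply_apply,
      ContinuousAlternatingMap.coe_zero, Pi.zero_apply] at h
    rwa [← hv, Matrix.vecCons, Fin.cons_self_tail] at h
  have h1 : ∀ (v : Fin (q + 1) → E) (i : Fin (q + 1)), v i = H → α v = 0 := fun v i hv => by
    by_cases hi : i = 0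
    · subst hi
      exact h0 v hv
    · have h := α.toAlternatingMap.map_swap v (Ne.symm hi)
      rw [ContinuousAlternatingMap.coe_toAlternatingMap,
        h0 _ (by simp [Function.comp_apply, Equiv.swap_apply_left, hv])] at h
      exact neg_eq_zero.mp h.symm
  have h2 : ∀ (v : Fin (q + 1) → E) (i : Fin (q + 1)) (t : ℝ), v i = t • H → α v = 0 := by
    intro v i t hv
    rw [← Function.update_eq_self i v, hv, α.map_update_smul, h1 _ i (Function.update_self ..),
      smul_zero]
  ext v
  simp only [ContinuousAlternatingMap.compContinuousLinearMap_apply]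
  rw [show (⇑(A + ℓ.smulRight H) ∘ v) = (⇑A ∘ v) + fun i => ℓ (v i) • H from
    funext fun i => by simp, α.map_add_univ, Finset.sum_eq_single Finset.univ]
  · rw [Finset.piecewise_univ]
  · intro s _ hs
    obtain ⟨i, hi⟩ : ∃ i, i ∉ s := by
      by_contra h
      exact hs (Finset.eq_univ_iff_forall.mpr (by simpa using h))
    exact h2 _ i (ℓ (v i)) (by rw [Finset.piecewise_eq_of_notMem _ _ _ hi])
  · exact fun h => absurd (Finset.mem_univ _) h

/-- **`H ↦ N_{K_∞/ℝ}(det H)²` is smooth on `hermSpace n K`**: `det` is a polynomial in the entries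
(Leibniz expansion) and `N² = ∏_w (‖det H_w‖²)^{mult w}`. [folklore] -/
theorem contDiff_norm_det_sq {n : ℕ} {K : Type} [Field K] [NumberField K] :
    ContDiff ℝ ∞ (fun H : ResGLnCone.hermSpace n K => mixedEmbedding.norm H.1.det ^ 2) := by
  -- adapted from Literature/Analysis/Pluripotential/MongeAmpereStokes.lean (contDiff_matrix_det)
  have hdet : ContDiff ℝ ∞ (fun H : ResGLnCone.hermSpace n K => H.1.det) := by
    have h1 : ContDiff ℝ ∞ (fun H : ResGLnCone.hermSpace n K => H.1) :=
      (ResGLnCone.hermSpace n K).subtypeL.contDiff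
    simp only [Matrix.det_apply']
    exact ContDiff.sum fun σ _ => contDiff_const.mul (contDiff_prod fun i _ =>
      (contDiff_apply_apply ℝ (mixedSpace K) (σ i) i).comp h1)
  have h : (fun H : ResGLnCone.hermSpace n K => mixedEmbedding.norm H.1.det ^ 2) =
      fun H => ∏ w : InfinitePlace K, ((normAtPlace w H.1.det) ^ 2) ^ w.mult := by
    funext H
    rw [mixedEmbedding.norm_apply, ← Finset.prod_pow]
    exact Finset.prod_congr rfl fun w _ => by rw [← pow_mul, ← pow_mul, mul_comm]
  rw [h]
  refine contDiff_prod fun w _ => ContDiff.pow ?_ _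
  by_cases hw : w.IsReal
  · simp_rw [normAtPlace_apply_of_isReal hw]
    exact (contDiff_pi.mp hdet.fst ⟨w, hw⟩).norm_sq ℝ
  · rw [InfinitePlace.not_isReal_iff_isComplex] at hw
    simp_rw [normAtPlace_apply_of_isComplex hw]
    exact (contDiff_pi.mp hdet.snd ⟨w, hw⟩).norm_sq ℂ

end Radial

/-- **Stub RADIAL — the radial projection of the positive cone onto `{N = 1}`.**
`N(H) = N_{K_∞/ℝ}(det H)` is positive on the cone and homogeneous of degree `n [K:ℚ]`;
`p(H) = N(H)^{-1/(n[K:ℚ])} H` is a smooth scale-invariant retraction of the cone onto `{N = 1}`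
commuting with every `g` with `|N(det g)| = 1`, with polynomially bounded first two derivatives,
and `p^*ω = ω` for basic forms `ω` (`N, e, p` are given through `hN, he, hp`). [folklore] -/
theorem stub_radialProjection (n : ℕ) (K : Type) [Field K] [NumberField K] (hn : 0 < n)
    (N : ResGLnCone.hermSpace n K → ℝ)
    (hN : ∀ H, N H = mixedEmbedding.norm (Matrix.det (H : Matrix (Fin n) (Fin n) (mixedSpace K))))
    (e : ℝ) (he : e = 1 / ((n : ℝ) * (Module.finrank ℚ K : ℝ)))
    (p : ResGLnCone.hermSpace n K → ResGLnCone.hermSpace n K) (hp : ∀ H, p H = (N H) ^ (-e) • H) :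
    (∀ H ∈ ResGLnCone.posCone n K, 0 < N H) ∧
    (∀ (r : ℝ), 0 < r → ∀ H : ResGLnCone.hermSpace n K, N (r • H) = r ^ (n * Module.finrank ℚ K) * N H) ∧
    (∀ H ∈ ResGLnCone.posCone n K, p H ∈ ResGLnCone.posCone n K ∧ N (p H) = 1) ∧
    (∀ (r : ℝ), 0 < r → ∀ H ∈ ResGLnCone.posCone n K, p (r • H) = p H) ∧
    ContDiffOn ℝ ((⊤ : ℕ∞) : WithTop ℕ∞) p (ResGLnCone.posCone n K) ∧
    (∀ g : GL (Fin n) (mixedSpace K),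
      |mixedEmbedding.norm (Matrix.det ((g : Matrix (Fin n) (Fin n) (mixedSpace K))))| = 1 →
        ∀ H ∈ ResGLnCone.posCone n K, p (ResGLnCone.coneAction n K g H) = ResGLnCone.coneAction n K g (p H)) ∧
    (∃ (C : ℝ) (k : ℕ), ∀ H ∈ ResGLnCone.posCone n K, ∀ v w : ResGLnCone.hermSpace n K,
      ‖fderiv ℝ p H v‖ ≤ C * (1 + ‖H‖ + (N H)⁻¹) ^ k * ‖v‖ ∧
        ‖iteratedFDeriv ℝ 2 p H ![v, w]‖ ≤ C * (1 + ‖H‖ + (N H)⁻¹) ^ k * ‖v‖ * ‖w‖) ∧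
    ∀ {V : Type} [NormedAddCommGroup V] [NormedSpace ℝ V] {q : ℕ}
      (ω : ResGLnCone.hermSpace n K → ResGLnCone.hermSpace n K [⋀^Fin (q + 1)]→L[ℝ] V),
      (∀ (r : ℝ), 0 < r → ∀ H ∈ ResGLnCone.posCone n K,
        (ω (r • H)).compContinuousLinearMap (r • ContinuousLinearMap.id ℝ _) = ω H) →
      (∀ H ∈ ResGLnCone.posCone n K, (ω H).curryLeft H = 0) →
      ∀ H ∈ ResGLnCone.posCone n K, (ω (p H)).compContinuousLinearMap (fderiv ℝ p H) = ω H := by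
  obtain rfl : p = fun H => (N H) ^ (-e) • H := funext hp
  set m : ℕ := n * Module.finrank ℚ K with hm_def
  have hm : 1 ≤ m := Nat.one_le_iff_ne_zero.mpr (Nat.mul_ne_zero hn.ne' Module.finrank_pos.ne')
  have hm1 : (1 : ℝ) ≤ m := by exact_mod_cast hm
  have he' : e = 1 / (m : ℝ) := by rw [he, hm_def, Nat.cast_mul]
  have he₀ : 0 < e := by rw [he']; positivity
  have he₁ : e ≤ 1 := by rw [he', one_div]; exact inv_le_one_of_one_le₀ hm1
  have hem : e * m = 1 := by rw [he']; field_simp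
  have h1 : ∀ H ∈ ResGLnCone.posCone n K, 0 < N H := fun H hH => by
    rw [hN]
    refine lt_of_le_of_ne (mixedEmbedding.norm_nonneg _)
      (Ne.symm (mixedEmbedding.norm_ne_zero_iff.mpr fun w => ?_))
    by_cases hw : w.IsReal
    · rw [normAtPlace_apply_of_isReal hw, norm_ne_zero_iff, ← mixedSpaceEvalReal_apply,
        RingHom.map_det, RingHom.mapMatrix_apply]
      exact (hH.1 ⟨w, hw⟩).det_pos.ne'
    · rw [InfinitePlace.not_isReal_iff_isComplex] at hw
      rw [normAtPlace_apply_of_isComplex hw, norm_ne_zero_iff, ← mixedSpaceEvalComplex_apply,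
        RingHom.map_det, RingHom.mapMatrix_apply]
      exact (hH.2 ⟨w, hw⟩).det_pos.ne'
  have hN0 : ∀ H : ResGLnCone.hermSpace n K, 0 ≤ N H := fun H =>
    (hN H).symm ▸ mixedEmbedding.norm_nonneg _
  have h2 : ∀ r : ℝ, 0 < r → ∀ H : ResGLnCone.hermSpace n K,
      N (r • H) = r ^ (n * Module.finrank ℚ K) * N H := fun r hr H => by
    rw [hN, hN, Submodule.coe_smul, Matrix.det_smul_of_tower, Fintype.card_fin,
      mixedEmbedding.norm_smul, abs_of_nonneg (pow_nonneg hr.le _), ← pow_mul]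
  have hscal : ∀ r : ℝ, 0 < r → ∀ H : ResGLnCone.hermSpace n K,
      N (r • H) ^ (-e) = r⁻¹ * N H ^ (-e) := fun r hr H => by
    rw [h2 r hr H, Real.mul_rpow (pow_nonneg hr.le _) (hN0 H), ← hm_def,
      ← Real.rpow_natCast_mul hr.le, show (m : ℝ) * -e = -1 by rw [mul_neg, mul_comm, hem],
      Real.rpow_neg_one]
  have hcone : ∀ c : ℝ, 0 < c → ∀ H ∈ ResGLnCone.posCone n K, c • H ∈ ResGLnCone.posCone n K :=
    fun c hc H hH => ⟨fun w => by
      rw [Submodule.coe_smul, Matrix.map_smul (mixedSpaceEvalReal K w) c (fun _ => rfl)]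
      exact (hH.1 w).smul hc, fun w => by
      rw [Submodule.coe_smul, Matrix.map_smul (mixedSpaceEvalComplex K w) c (fun _ => rfl)]
      exact (hH.2 w).smul hc⟩
  have h3 : ∀ H ∈ ResGLnCone.posCone n K,
      N H ^ (-e) • H ∈ ResGLnCone.posCone n K ∧ N (N H ^ (-e) • H) = 1 := by
    intro H hH
    have hc : 0 < N H ^ (-e) := Real.rpow_pos_of_pos (h1 H hH) _
    refine ⟨hcone _ hc H hH, ?_⟩
    rw [h2 _ hc H, ← hm_def, ← Real.rpow_mul_natCast (hN0 H), show -e * (m : ℝ) = -1 by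
      rw [neg_mul, hem], Real.rpow_neg_one, inv_mul_cancel₀ (h1 H hH).ne']
  have hN2 : ContDiff ℝ ((⊤ : ℕ∞) : WithTop ℕ∞) fun H : ResGLnCone.hermSpace n K => N H ^ 2 := by
    rw [show (fun H => N H ^ 2) = fun H : ResGLnCone.hermSpace n K =>
      mixedEmbedding.norm H.1.det ^ 2 from funext fun H => by rw [hN]]
    exact Radial.contDiff_norm_det_sq
  obtain ⟨hsmooth, C, k, hCk⟩ := Radial.rpow_smul_calculus hN2 hN0 hm
    (fun r hr H => by rw [hm_def]; exact h2 r hr H) he₀ he₁ (ResGLnCone.isOpen_posCone n K) h1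
  refine ⟨h1, h2, h3, fun r hr H _ => ?_, fun H hH => (hsmooth H hH).1.contDiffWithinAt,
    fun g hg H _ => ?_, ⟨C, k, fun H hH v w => hCk H hH v w⟩, fun {V} _ _ {q} ω hsc hEu H hH => ?_⟩
  · -- (4) scale invariance
    show N (r • H) ^ (-e) • (r • H) = N H ^ (-e) • H
    rw [hscal r hr H, smul_smul, mul_comm, ← mul_assoc, mul_inv_cancel₀ hr.ne', one_mul]
  · -- (6) equivariance: `N(g H gᴴ) = N(H)` as `det gᴴ = star (det g)` and `N ∘ star = N`
    have hstar : ∀ x : mixedSpace K, mixedEmbedding.norm (star x) = mixedEmbedding.norm x := by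
      refine fun x => norm_eq_of_normAtPlace_eq fun w => ?_
      by_cases hw : w.IsReal
      · rw [normAtPlace_apply_of_isReal hw, normAtPlace_apply_of_isReal hw, Prod.fst_star,
          Pi.star_apply, norm_star]
      · rw [InfinitePlace.not_isReal_iff_isComplex] at hw
        rw [normAtPlace_apply_of_isComplex hw, normAtPlace_apply_of_isComplex hw, Prod.snd_star,
          Pi.star_apply, norm_star]
    rw [abs_of_nonneg (mixedEmbedding.norm_nonneg _)] at hg
    have key : N (ResGLnCone.coneAction n K g H) = N H := by
      rw [hN, hN, ResGLnCone.coe_coneAction, Matrix.det_mul, Matrix.det_mul,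
        Matrix.det_conjTranspose, map_mul, map_mul, hstar, hg, one_mul, mul_one]
    show N (ResGLnCone.coneAction n K g H) ^ (-e) • ResGLnCone.coneAction n K g H =
      ResGLnCone.coneAction n K g (N H ^ (-e) • H)
    rw [key, ContinuousLinearMap.map_smul]
  · -- (8) the pull-back of a basic form along `p` is the form itself
    obtain ⟨ℓ, hℓ⟩ := (hsmooth H hH).2
    have hc : 0 < N H ^ (-e) := Real.rpow_pos_of_pos (h1 H hH) _
    have hcurry : (ω (N H ^ (-e) • H)).curryLeft H = 0 := by
      have h := hEu (N H ^ (-e) • H) (h3 H hH).1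
      rw [map_smul, smul_eq_zero] at h
      exact h.resolve_left hc.ne'
    have hgoal : (ω (N H ^ (-e) • H)).compContinuousLinearMap
        (fderiv ℝ (fun H => N H ^ (-e) • H) H) = (ω (N H ^ (-e) • H)).compContinuousLinearMap
          (N H ^ (-e) • ContinuousLinearMap.id ℝ _ + ℓ.smulRight H) := by
      congr 1
    show (ω (N H ^ (-e) • H)).compContinuousLinearMap (fderiv ℝ (fun H => N H ^ (-e) • H) H) = ω H
    rw [hgoal]
    exact (Radial.compContinuousLinearMap_add_smulRight _ hcurry _ ℓ).trans (hsc _ hc H hH)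

end Summit.Langlands.Langlands.Theorems.HeckeEigenvalueField.Res

end
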